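import Summits.SmoothPoincare4.SmoothPoincare4.Theorems.InformationMetricHadamardAhHadamardFillingStubInstantonCollarPackageImmersionTransfer
import Summits.SmoothPoincare4.SmoothPoincare4.Theorems.InformationMetricHadamardAhHadamardFillingStubInstantonCollarPackageLpFamily
import Summits.SmoothPoincare4.SmoothPoincare4.Theorems.InformationMetricHadamardAhHadamardFillingStubInstantonCollarPackageTopology

/-!
# Smoothness of the transferred collar into a model of the moduli space
(crux `InformationMetricHadamard.AhHadamardFilling`, item stmt-SmoothPoincare4-6014, line
`fisher-sphere-gauss`, stub F `stub_instantonCollarPackage` — the Donaldson–Taubes collar of a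
model of the charge-one instanton moduli space). This file is the differential part of the
transfer of the collar `Ψ : Σ × (0, l₀) → M₁ = AsdModuliSpace g Σ.orientation 1` to a model
`ι : W → M₁` (`IsModuliModel`: an open topological embedding with closed range along which the
universal density is jointly smooth): the map `Φ : Σ × ℝ → W` determined on `Σ × (0,1)` by
`ι (Φ (σ, l)) = Ψ (σ, l₀ l / (l₀ + l))`, already known to be continuous
(`helper_collarTopologyTransfer`), is `C^∞` into the abstract smooth structure of `W`
(`helper_collarSmoothTransfer`).

Mechanism. Let `μ = dvol_g` (finite: `Σ` is compact) and `V = L²(Σ, μ)`. The Hellinger map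
`e : W → V`, `e w = [2√ρ_{ι w}]`, is `C^∞` (`contMDiff_toLp_family`: the family
`hellinger ι = 2√ρ` is jointly smooth since `ρ > 0`) with differential `X ↦ [D1 (hellinger ι) w X]`
(`mvfderiv_toLp_family`), whose `L²`-norm squared is the Fisher form `𝓘(w)(X, X) > 0` for
`X ≠ 0`; hence `e` is an immersion. On the collar domain, `e ∘ Φ = θ_Σ ∘ r` where
`r (σ, l) = (σ, l₀ l / (l₀ + l))` is smooth `Σ × (0,1) → Σ × (0, l₀)` and
`θ_Σ q = [2√ρ_{Ψ q}]` is `C^∞` on `Σ × (0, l₀)` (`helper_toLp_family_manifold`: the densities of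
the collar are jointly smooth and positive, the collar lying in `range ι`). So `e ∘ Φ` is `C^∞`,
and a continuous map into an immersed submanifold which is smooth into the ambient Hilbert space
is smooth (`helper_contMDiffOn_of_comp_immersion`; Lee, *Introduction to Smooth Manifolds*,
Thm. 5.29).
Authorship: stub-worker of the line lead prover-line-stmt-SmoothPoincare4-6014-c5-0 (wave 3).

References: J. M. Lee, *Introduction to Smooth Manifolds* (2nd ed. 2013), Thm. 5.29;
D. Groisser, M. K. Murray, *Instantons and the information metric*, Ann. Global Anal. Geom. 15
(1997), dg-ga/9611008, §2–3; J. Dieudonné, *Foundations of Modern Analysis* (1960), (8.11.2).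
-/

noncomputable section

-- the prescribed namespace `Summit.<P>.<Sub>.…` duplicates `SmoothPoincare4` (P = Sub)
set_option linter.dupNamespace false

open scoped Manifold ContDiff Topology ENNReal NNReal RealInnerProductSpace
open Set Function MeasureTheory Topology Filter

namespace Summit.SmoothPoincare4.SmoothPoincare4.Cruxes.AhHadamardFilling.FisherSphereGauss

open Literature.Topology.FourManifolds (HomotopySphere)
open Literature.Geometry.Lorentzian (PseudoRiemannianMetric riemannianMeasure)
open Literature.Geometry.GaugeTheory (AsdModuliSpace)

/-- The scale reparametrisation `(σ, l) ↦ (σ, l₀ l / (l₀ + l))` is `C^∞` on `Σ × (0, 1)` (for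
`l₀ > 0` the denominator does not vanish there) and maps it into `Σ × (0, l₀)`
(`collarScale_pos`, `collarScale_lt_self`). [folklore] -/
theorem contMDiffOn_collarReparam {N : Type*} [TopologicalSpace N]
    [ChartedSpace (EuclideanSpace ℝ (Fin 4)) N] {l₀ : ℝ} (hl₀ : 0 < l₀) :
    ContMDiffOn ((𝓡 4).prod 𝓘(ℝ, ℝ)) ((𝓡 4).prod 𝓘(ℝ, ℝ)) ∞
        (fun p : N × ℝ ↦ (p.1, l₀ * p.2 / (l₀ + p.2))) (univ ×ˢ Ioo (0 : ℝ) 1) ∧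
      MapsTo (fun p : N × ℝ ↦ (p.1, l₀ * p.2 / (l₀ + p.2))) (univ ×ˢ Ioo (0 : ℝ) 1)
        (univ ×ˢ Ioo (0 : ℝ) l₀) := by
  refine ⟨contMDiffOn_fst.prodMk fun p hp ↦ ?_, fun p hp ↦
    ⟨mem_univ _, collarScale_pos hl₀ hp.2.1, collarScale_lt_self hl₀ hp.2.1⟩⟩
  have h : ContDiffAt ℝ ∞ (fun l : ℝ ↦ l₀ * l / (l₀ + l)) p.2 :=
    (contDiffAt_const.mul contDiffAt_id).div (contDiffAt_const.add contDiffAt_id)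
      (add_pos hl₀ hp.2.1).ne'
  exact h.comp_contMDiffWithinAt (f := Prod.snd) contMDiffWithinAt_snd

/-- **A smooth map into `L²` whose differential realises a positive definite form is an
immersion.** If `e : W → V` has vector-valued manifold derivative `d e_w X = [D w X]` for
continuous representatives `D w X ∈ C(N, ℝ)` and `∫ (D w X)² dμ > 0` for `X ≠ 0`, then
`mfderiv e w` is injective for every `w` (`‖d e_w X‖² = ∫ (D w X)² dμ`, `inner_toLp_toLp`; the
vector-valued derivative `mvfderiv` is `mfderiv` followed by the canonical identification
`T_{e w} V = V`). [folklore] -/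
theorem injective_mfderiv_of_pos
    {N : Type*} [TopologicalSpace N] [CompactSpace N] [MeasurableSpace N] [BorelSpace N]
    {μ : Measure N} [IsFiniteMeasure μ]
    {W : Type*} [TopologicalSpace W] [ChartedSpace (EuclideanSpace ℝ (Fin 5)) W]
    {e : W → Lp ℝ 2 μ} {D : W → EuclideanSpace ℝ (Fin 5) → C(N, ℝ)}
    (hd : ∀ (w : W) (X : EuclideanSpace ℝ (Fin 5)),
      mvfderiv (𝓡 5) e w X = ContinuousMap.toLp (E := ℝ) 2 μ ℝ (D w X))
    (hpos : ∀ (w : W) (X : EuclideanSpace ℝ (Fin 5)), X ≠ 0 → 0 < ∫ x, D w X x * D w X x ∂μ)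
    (w : W) : Injective (mfderiv (𝓡 5) 𝓘(ℝ, Lp ℝ 2 μ) e w) := by
  have h2 : Injective (mvfderiv (𝓡 5) e w) := by
    rw [injective_iff_map_eq_zero]
    intro X hX
    by_contra hne
    have h := hpos w X hne
    rw [← inner_toLp_toLp, ← hd, hX, inner_zero_left] at h
    exact lt_irrefl 0 h
  intro X Y hXY
  apply h2
  change (NormedSpace.fromTangentSpace (e w)) (mfderiv (𝓡 5) 𝓘(ℝ, Lp ℝ 2 μ) e w X) =
    (NormedSpace.fromTangentSpace (e w)) (mfderiv (𝓡 5) 𝓘(ℝ, Lp ℝ 2 μ) e w Y)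
  rw [hXY]

/-- **Smoothness of the transferred collar** (helper of stub F `stub_instantonCollarPackage`).
Let `ι : W → M₁(Σ, g)` be a moduli model with positive densities and positive definite Fisher
form of the Hellinger family `hellinger ι = 2√ρ`, `Ψ : Σ × ℝ → M₁` a collar over `(0, l₀)` whose
densities `(q, x) ↦ ρ_{Ψ q}(x)` are jointly `C^∞` on `(Σ × (0, l₀)) × Σ` and which lies in
`range ι`, and `Φ : Σ × ℝ → W` a map, continuous on `Σ × (0,1)`, with
`ι (Φ (σ, l)) = Ψ (σ, l₀ l / (l₀ + l))` there. Then `Φ` is `C^∞` on `Σ × (0,1)` into the model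
`W`. Proof: with `μ = dvol_g` on the Borel σ-algebra (finite) and `V = L²(Σ, μ)`, the Hellinger
map `e w = [hellinger ι w] : W → V` is a `C^∞` immersion (`contMDiff_toLp_family`,
`mvfderiv_toLp_family`, `injective_mfderiv_of_pos` with the Fisher form), `e ∘ Φ = θ_Σ ∘ r` on
the domain with `θ_Σ q = [2√ρ_{Ψ q}]` smooth on `Σ × (0, l₀)` (`helper_toLp_family_manifold`;
`√` is smooth at the positive values `ρ_{Ψ q}(x) = ρ_{ι w}(x)`) and `r` the smooth scale
reparametrisation (`contMDiffOn_collarReparam`); conclude by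
`helper_contMDiffOn_of_comp_immersion`. [cite: LeeSmoothManifolds2013, Thm 5.29] -/
theorem helper_collarSmoothTransfer (S : HomotopySphere 4) [Nonempty S.carrier]
    (g : PseudoRiemannianMetric (𝓡 4) ∞ (EuclideanSpace ℝ (Fin 4)) (TangentSpace (𝓡 4) : S.carrier → Type _))
    (hg : g.IsRiemannian)
    (W : Type) [TopologicalSpace W]
    [ChartedSpace (EuclideanSpace ℝ (Fin 5)) W] [IsManifold (𝓡 5) ∞ W]
    (ι : W → AsdModuliSpace g S.orientation 1) (hmod : IsModuliModel ι)
    (hρ : ∀ (w : W) (x : S.carrier), 0 < (ι w).density g x)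
    (hpos : ∀ (w : W) (X : EuclideanSpace ℝ (Fin 5)), X ≠ 0 → 0 < fisherForm g hg (hellinger ι) w X X)
    {l₀ : ℝ} (hl₀ : 0 < l₀) {Ψ : S.carrier × ℝ → AsdModuliSpace g S.orientation 1}
    (hΨρ : ContMDiffOn (((𝓡 4).prod 𝓘(ℝ, ℝ)).prod (𝓡 4)) 𝓘(ℝ, ℝ) ∞
      (fun q : (S.carrier × ℝ) × S.carrier ↦ (Ψ q.1).density g q.2) ((univ ×ˢ Ioo 0 l₀) ×ˢ univ))
    (hΨW : ∀ p ∈ (univ : Set S.carrier) ×ˢ Ioo (0 : ℝ) l₀, Ψ p ∈ range ι)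
    {Φ : S.carrier × ℝ → W}
    (hΦ : ∀ p ∈ (univ : Set S.carrier) ×ˢ Ioo (0 : ℝ) 1, ι (Φ p) = Ψ (p.1, l₀ * p.2 / (l₀ + p.2)))
    (hΦc : ContinuousOn Φ (univ ×ˢ Ioo (0 : ℝ) 1)) :
    ContMDiffOn ((𝓡 4).prod 𝓘(ℝ, ℝ)) (𝓡 5) ∞ Φ (univ ×ˢ Ioo (0 : ℝ) 1) := by
  classical
  -- the finite Borel measure `μ = dvol_g` on the compact `Σ`
  letI : MeasurableSpace S.carrier := borel _
  haveI : BorelSpace S.carrier := ⟨rfl⟩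
  haveI : IsFiniteMeasure (riemannianMeasure (g.toContMDiffRiemannianMetric hg)) :=
    ⟨Literature.Geometry.Lorentzian.riemannianVolume_lt_top_of_isCompact_holds _ le_rfl
      isCompact_univ⟩
  set μ : Measure S.carrier := riemannianMeasure (g.toContMDiffRiemannianMetric hg)
  -- (1) the Hellinger family is jointly smooth (`√` is smooth on `(0, ∞)`)
  have hθ : ContMDiff ((𝓡 5).prod (𝓡 4)) 𝓘(ℝ, ℝ) ∞
      (fun p : W × S.carrier ↦ hellinger ι p.1 p.2) := by
    intro p
    have h2 : ContDiffAt ℝ ∞ (fun r : ℝ ↦ 2 * Real.sqrt r) ((ι p.1).density g p.2) :=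
      contDiffAt_const.mul (Real.contDiffAt_sqrt (hρ p.1 p.2).ne')
    exact h2.comp_contMDiffAt (f := fun q : W × S.carrier ↦ (ι q.1).density g q.2)
      (hmod.contMDiff_density p)
  have hθc : ∀ w, Continuous (hellinger ι w) := continuous_family hθ
  -- the Hellinger map `e : W → V = L²(Σ, μ)`, a smooth immersion
  obtain ⟨e, heq⟩ : ∃ e : W → Lp ℝ 2 μ, e = fun w ↦
      ContinuousMap.toLp (E := ℝ) 2 μ ℝ (⟨hellinger ι w, hθc w⟩ : C(S.carrier, ℝ)) := ⟨_, rfl⟩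
  have he : ContMDiff (𝓡 5) 𝓘(ℝ, Lp ℝ 2 μ) ∞ e := by
    rw [heq]; exact contMDiff_toLp_family hθ hθc
  have hd : ∀ (w : W) (X : EuclideanSpace ℝ (Fin 5)), mvfderiv (𝓡 5) e w X =
      ContinuousMap.toLp (E := ℝ) 2 μ ℝ
        ⟨fun x ↦ D1 (hellinger ι) w X x, continuous_D1 hθ w X⟩ := by
    intro w X; rw [heq]; exact mvfderiv_toLp_family hθ hθc w X fun x ↦ rfl
  have hinj : ∀ w, Injective (mfderiv (𝓡 5) 𝓘(ℝ, Lp ℝ 2 μ) e w) :=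
    injective_mfderiv_of_pos hd fun w X hX ↦ hpos w X hX
  -- (2) the Hellinger map of the collar, `θ_Σ q = [2√ρ_{Ψ q}]`, is smooth on `Σ × (0, l₀)`
  have hs : IsOpen ((univ : Set S.carrier) ×ˢ Ioo (0 : ℝ) l₀) := isOpen_univ.prod isOpen_Ioo
  have hρΨ : ContMDiffOn (((𝓡 4).prod 𝓘(ℝ, ℝ)).prod (𝓡 4)) 𝓘(ℝ, ℝ) ∞
      (fun q : (S.carrier × ℝ) × S.carrier ↦ 2 * Real.sqrt ((Ψ q.1).density g q.2))
      ((univ ×ˢ Ioo 0 l₀) ×ˢ univ) := by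
    intro q hq
    obtain ⟨w, hw⟩ := hΨW q.1 hq.1
    have hpos' : 0 < (Ψ q.1).density g q.2 := by rw [← hw]; exact hρ w q.2
    have h2 : ContDiffAt ℝ ∞ (fun r : ℝ ↦ 2 * Real.sqrt r) ((Ψ q.1).density g q.2) :=
      contDiffAt_const.mul (Real.contDiffAt_sqrt hpos'.ne')
    exact h2.comp_contMDiffWithinAt
      (f := fun q : (S.carrier × ℝ) × S.carrier ↦ (Ψ q.1).density g q.2) (hΨρ q hq)
  have hcΨ : ∀ q ∈ (univ : Set S.carrier) ×ˢ Ioo (0 : ℝ) l₀,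
      Continuous fun x ↦ 2 * Real.sqrt ((Ψ q).density g x) := fun q hq ↦
    hρΨ.continuousOn.comp_continuous (f := fun x : S.carrier ↦ (q, x))
      (continuous_const.prodMk continuous_id) fun x ↦ ⟨hq, mem_univ _⟩
  obtain ⟨F, hFdef⟩ : ∃ F : S.carrier × ℝ → C(S.carrier, ℝ), F = fun q ↦
      if hq : q ∈ (univ : Set S.carrier) ×ˢ Ioo (0 : ℝ) l₀ then
        ⟨fun x ↦ 2 * Real.sqrt ((Ψ q).density g x), hcΨ q hq⟩ else 0 := ⟨_, rfl⟩
  have hFapp : ∀ q ∈ (univ : Set S.carrier) ×ˢ Ioo (0 : ℝ) l₀, ∀ x,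
      F q x = 2 * Real.sqrt ((Ψ q).density g x) := by
    intro q hq x
    simp only [hFdef, dif_pos hq, ContinuousMap.coe_mk]
  have hθΨ : ContMDiffOn ((𝓡 4).prod 𝓘(ℝ, ℝ)) 𝓘(ℝ, Lp ℝ 2 μ) ∞
      (fun q ↦ ContinuousMap.toLp (E := ℝ) 2 μ ℝ (F q)) (univ ×ˢ Ioo (0 : ℝ) l₀) :=
    (helper_toLp_family_manifold (IM := (𝓡 4).prod 𝓘(ℝ, ℝ)) (IK := 𝓡 4) μ
      (ρ := fun (q : S.carrier × ℝ) (x : S.carrier) ↦ 2 * Real.sqrt ((Ψ q).density g x))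
      hs hρΨ hFapp).1
  -- (3) `e ∘ Φ = θ_Σ ∘ r` on `Σ × (0, 1)`, hence smooth
  obtain ⟨hr, hrs⟩ := contMDiffOn_collarReparam (N := S.carrier) hl₀
  have hΦe : ContMDiffOn ((𝓡 4).prod 𝓘(ℝ, ℝ)) 𝓘(ℝ, Lp ℝ 2 μ) ∞ (e ∘ Φ)
      (univ ×ˢ Ioo (0 : ℝ) 1) := by
    refine (hθΨ.comp hr hrs).congr fun p hp ↦ ?_
    rw [heq]
    simp only [Function.comp_apply]
    congr 1
    ext x
    rw [hFapp _ (hrs hp), ContinuousMap.coe_mk, hellinger, hΦ p hp]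
  -- (4) a continuous map into an immersed submanifold, smooth into the ambient space, is smooth
  exact helper_contMDiffOn_of_comp_immersion he hinj (isOpen_univ.prod isOpen_Ioo) hΦc hΦe

end Summit.SmoothPoincare4.SmoothPoincare4.Cruxes.AhHadamardFilling.FisherSphereGauss

end
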